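import Mathlib
import Summits.QuantumFields.YangMills.Theorems.CoarseStiffnessTailCappedCoarseStiffnessLLargeFieldCount
import Literature.MathematicalPhysics.QuantumFieldTheory.Balaban1983to89.T3FinestHeightJointTail

/-!
# Route `CoarseStiffnessTail` — THE BARE (`j = 0`) FACE OF THE UNIFORM LARGE-FIELD COUNT HOLDS: the registered EDGE stub of crux
# `CappedCoarseStiffnessL` at the finest height, unconditionally, with the crux's UNIFORM constants (lead's certificate, seat
# `ym-line-cst-p1` g9; helper on 25301)

THE THEOREM (`bare_uniformLargeFieldCount`; constants `c₀ = 1/24`, `C₀ = log 2`, `γ₁ = γ₁(b₀)` explicit).  For every `L`, every profile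
`(b₀, p₀)` with `0 < b₀`, `1 ≤ p₀` (the crux asks `2 < p₀`) there is `γ₁ ∈ (0, 1]` such that for EVERY three-torus family `F`, every coupling
`0 < γ ≤ γ₁` and EVERY cut-off `K`, the bare (`j = 0`) Wilson–Gibbs law `Gibbs_K` (coupling `β_K = (γL^{-K})⁻¹`) satisfies

  `∫ exp((1/24)·p(g_K)²·N_0(U)) dGibbs_K ≤ exp(log 2 · #Plaq_0)`,   `N_0(U) = #{p ∈ Plaq_0 : θ(K) ≤ |U(∂p) − 1|}`,

`θ(K) = g_K p(g_K)`, `g_K = β_K^{-1/2}`, `p = B10.pFun b₀ p₀` — i.e. the registered stub `stub_uniformLargeFieldCount` of the crux's skeleton v4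
(`Cruxes/CappedCoarseStiffnessL/Lines/birth.lean`) RESTRICTED TO `j = 0`, with constants uniform in `K`, in the volume exponent `m` and in
`γ ≤ γ₁` — NO `log β_K` allowance (contrast the landed `CoarseStiffnessTailLargeFieldCountGlue.bare_largeFieldCount`: `C + 2·log β_K` per plaquette).

PROOF.  §1 `jointPeierls_bare`: for every finite family `S` of bare plaquettes `Gibbs_K{∀ q ∈ S : θ(K) ≤ |U(∂q) − 1|} ≤ exp(−(p(g_K)²/24)·|S|)` once
`γ ≤ γ₁(b₀)` — the tree's JOINT Peierls–chessboard tail at the finest height (`T3FinestHeightJointTail.gibbsK_real_forall_dist1_ge_le`: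
rate `(min δ 1)^{|S|/3}`, `δ = 2e^{24}c⁻³(√β_K)^9 e^{−p²/4}`; reflection positivity + Fröhlich–Israel–Lieb–Simon for plaquette FAMILIES) and the
arithmetic `p(g_K)² ≥ 8·log(2e^{24}c⁻³) + 72·log √β_K` for `log √β_K ≥ x₀(b₀)` (`sq_pFun_ge`, uses only `p₀ ≥ 1`: `p² = b₀²(1 + log √β)^{2p₀}`), so
`δ ≤ e^{−p²/8}`.  §2: «joint Peierls for all subfamilies ⇒ count exponential moment» (`CoarseStiffnessTailLargeFieldCount.integral_exp_count_le_of_jointPeierls`,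
p635820: `∫e^{sN} ≤ B·2^{#Plaq}` for `s ≤ t`) with `s = t = p²/24`, `B = 1`.

READING (line card `Cruxes/CappedCoarseStiffnessL/Lines/birth.md` §g9).  By g8's factorisation `CappedCoarseStiffnessL ⇔ SubThresholdStiffness (BULK) ∧
UniformLargeFieldCount (EDGE)` the crux's `j = 0` rung splits into BULK₀ and EDGE₀.  The g2 memo showed BULK₀ is NOT elementary uniformly in `γ`
(flat-connection zero modes: a uniform Laplace-exponent statement).  THIS FILE shows EDGE₀ IS elementary uniformly in `γ`: the Haar entropy
`(9/2)·log β_K` that the chessboard localises ON THE FAMILY is beaten by `p(g_K)² ≍ (log β_K)^{2p₀}`.  So g2's obstruction lives entirely in the BULK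
conjunct — the one no consumer of this line reads (g5/g7/g8).  Nothing here touches `j ≥ 1` (block-averaged plaquettes at super-logarithmic depth:
the located renormalisation-group content, [Balaban1985UV3] (71) / [Balaban1989LargeFieldII] §0).

HONEST SCOPE.  An elementary, unconditional theorem about the bare Wilson theory at weak coupling, composed from tree theorems by name; the EDGE
stub at `j ≥ 1`, the BULK stub, the crux 25301 and `HistoryTailL` 19936 stay OPEN; `YM3TorusSU2` (R3, RECORD rung, not Clay) is NOT proved; the
Yang–Mills mass gap is NOT touched.

References: J. Fröhlich, R. Israel, E. Lieb, B. Simon, CMP **62** (1978) 1–34 [FrohlichIsraelLiebSimon1978] (Thm 4.1); T. Bałaban, CMP **102**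
(1985) 255–275 [Balaban1985UV3] ((7) p.257: `p(g) = b₀(1 + log g⁻¹)^{p₀}`, `ε₁ = g p(g)`; (71) p.273: the factor `exp(−¼p(g_k)²)` per large plaquette).
-/

noncomputable section

namespace Summit.QuantumFields.YangMills.Theorems.CoarseStiffnessTailBareUniformCount

open MeasureTheory Finset
open Literature.MathematicalPhysics.QuantumFieldTheory
open Literature.MathematicalPhysics.QuantumFieldTheory.Balaban1983to89
open Literature.MathematicalPhysics.QuantumFieldTheory.Balaban1983to89.T3ContinuumYM3Torus
open Literature.MathematicalPhysics.QuantumFieldTheory.Balaban1983to89.T3UnitScaleTilt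
open Literature.MathematicalPhysics.QuantumFieldTheory.Balaban1983to89.T3UnitLawDensityEML
open Literature.MathematicalPhysics.QuantumFieldTheory.Balaban1983to89.T3FinestHeightJointTail (gibbsK_real_forall_dist1_ge_le)
open Summit.QuantumFields.YangMills.Theorems.CoarseStiffnessTailLargeFieldCount
  (integral_exp_count_le_of_jointPeierls measurable_count count_mem)

/-! ## §0 Arithmetic of the profile `p(g) = b₀(1 + log g⁻¹)^{p₀}` -/

section Arithmetic

/-- **THE PROFILE BEATS THE ENTROPY**: for `0 < b₀`, `1 ≤ p₀`, `0 ≤ A` and `x = log g⁻¹ ≥ x₀ := (8A + 72)/b₀²` (`x ≥ 0`):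
`8A + 72·x ≤ p(g)² = b₀²(1 + x)^{2p₀}` — since `(1 + x)^{p₀} ≥ 1 + x` and `b₀²(1 + x)² ≥ b₀²x₀(1 + x) = (8A + 72)(1 + x)`. [folklore] -/
theorem sq_pFun_ge {b₀ p₀ A g : ℝ} (hb₀ : 0 < b₀) (hp₀ : 1 ≤ p₀) (hA : 0 ≤ A)
    (hx : (8 * A + 72) / b₀ ^ 2 ≤ Real.log g⁻¹) :
    8 * A + 72 * Real.log g⁻¹ ≤ B10.pFun b₀ p₀ g ^ 2 := by
  set x : ℝ := Real.log g⁻¹ with hxdef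
  have hb2 : 0 < b₀ ^ 2 := pow_pos hb₀ 2
  have hx0 : 0 ≤ x := le_trans (div_nonneg (by linarith) hb2.le) hx
  have hy1 : 1 ≤ 1 + x := by linarith
  have hy0 : 0 ≤ 1 + x := by linarith
  -- `(1 + x)^{p₀} ≥ 1 + x`
  have hrpow : 1 + x ≤ (1 + x) ^ p₀ := by
    calc 1 + x = (1 + x) ^ (1 : ℝ) := (Real.rpow_one _).symm
      _ ≤ (1 + x) ^ p₀ := Real.rpow_le_rpow_of_exponent_le hy1 hp₀
  have hpf : B10.pFun b₀ p₀ g = b₀ * (1 + x) ^ p₀ := rfl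
  rw [hpf, mul_pow]
  have hsq : (1 + x) ^ 2 ≤ ((1 + x) ^ p₀) ^ 2 := pow_le_pow_left₀ hy0 hrpow 2
  -- `b₀² x₀ = 8A + 72` and `x₀ ≤ x`
  have hx' : 8 * A + 72 ≤ b₀ ^ 2 * x := by
    have := mul_le_mul_of_nonneg_left hx hb2.le
    rwa [mul_div_cancel₀ _ hb2.ne'] at this
  calc 8 * A + 72 * x ≤ (8 * A + 72) * (1 + x) := by nlinarith
    _ ≤ b₀ ^ 2 * x * (1 + x) := mul_le_mul_of_nonneg_right hx' hy0
    _ ≤ b₀ ^ 2 * (1 + x) ^ 2 := by nlinarith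
    _ ≤ b₀ ^ 2 * ((1 + x) ^ p₀) ^ 2 := mul_le_mul_of_nonneg_left hsq hb2.le

/-- `p(g) ≥ 0` for `b₀ ≥ 0` and `0 < g ≤ 1` (then `1 + log g⁻¹ ≥ 1`). [folklore] -/
theorem pFun_nonneg {b₀ p₀ g : ℝ} (hb₀ : 0 ≤ b₀) (hg : 0 < g) (hg1 : g ≤ 1) : 0 ≤ B10.pFun b₀ p₀ g := by
  have hlog : 0 ≤ Real.log g⁻¹ := Real.log_nonneg (one_le_inv₀ hg |>.mpr hg1)
  exact mul_nonneg hb₀ (Real.rpow_nonneg (by linarith) _)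

end Arithmetic

/-! ## §1 The joint Peierls bound for bare plaquettes at the threshold `θ(K)`, with rate `p(g_K)²/24`, uniformly in the volume -/

section Peierls

variable (F : T3Family)

/-- The bare coupling `g_K = √(γL^{-K}) ∈ (0, √γ]` and `β_K = (γL^{-K})⁻¹ ≥ 1` for `0 < γ ≤ 1`. [cite: Balaban1985UV3, (1)-(3) p.256] -/
theorem coupling_facts {γ : ℝ} (hγ : 0 < γ) (hγ1 : γ ≤ 1) (K : ℕ) :
    0 < γ * ((F.L : ℝ)⁻¹) ^ K ∧ γ * ((F.L : ℝ)⁻¹) ^ K ≤ γ ∧ 1 ≤ (γ * ((F.L : ℝ)⁻¹) ^ K)⁻¹ := by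
  have hL1 : (1 : ℝ) ≤ F.L := by exact_mod_cast F.hL.2.le
  have hL0 : (0 : ℝ) < F.L := one_pos.trans_le hL1
  have hx0 : 0 < γ * ((F.L : ℝ)⁻¹) ^ K := mul_pos hγ (pow_pos (inv_pos.mpr hL0) K)
  have hp : ((F.L : ℝ)⁻¹) ^ K ≤ 1 := pow_le_one₀ (inv_nonneg.mpr hL0.le) (inv_le_one_of_one_le₀ hL1)
  have hxγ : γ * ((F.L : ℝ)⁻¹) ^ K ≤ γ := by nlinarith
  exact ⟨hx0, hxγ, (one_le_inv₀ hx0).mpr (hxγ.trans hγ1)⟩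

/-- **JOINT PEIERLS FOR BARE PLAQUETTES, RATE `p(g_K)²/24`, UNIFORM IN THE VOLUME AND IN `γ ≤ γ₁(b₀)`.**  For `0 < b₀`, `1 ≤ p₀` there is
`γ₁ ∈ (0, 1]` (explicitly `γ₁ = exp(−2(8A + 72)/b₀²)`, `A = log(2e^{24}c⁻³)`, `c` the `SU(2)` Haar small-ball constant) such that for every family
`F`, every `0 < γ ≤ γ₁`, every cut-off `K` and EVERY finite family `S` of plaquettes of the finest torus:
`Gibbs_K{∀ q ∈ S, θ(K) ≤ |U(∂q) − 1|} ≤ exp(−(p(g_K)²/24)·|S|)` — the joint chessboard tail `(min δ 1)^{|S|/3}` with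
`δ = 2e^{24}c⁻³(√β_K)^9 e^{−p²/4} ≤ e^{−p²/8}` by §0 (`log √β_K = log g_K⁻¹ ≥ x₀`). [cite: Balaban1985UV3, (71) p.273; FrohlichIsraelLiebSimon1978, Thm 4.1] -/
theorem jointPeierls_bare {b₀ p₀ : ℝ} (hb₀ : 0 < b₀) (hp₀ : 1 ≤ p₀) :
    ∃ γ₁ : ℝ, 0 < γ₁ ∧ γ₁ ≤ 1 ∧ ∀ (F : T3Family) (γ : ℝ), 0 < γ → γ ≤ γ₁ → ∀ (K : ℕ) (S : Finset (Plaq (F.P K) 0)),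
      (gibbsK F ℰp γ K).real {U | ∀ q ∈ S, θBal F.L γ b₀ p₀ K ≤ GaugeGroup.dist1 (GaugeField.plaqHol U q)} ≤
        Real.exp (-(B10.pFun b₀ p₀ (Real.sqrt (γ * ((F.L : ℝ)⁻¹) ^ K)) ^ 2 / 24) * (S.card : ℝ)) := by
  obtain ⟨c, hc, hc1, htail⟩ := gibbsK_real_forall_dist1_ge_le
  -- the entropy constant `A = log(2e^{24}c⁻³) ≥ 0` and the threshold `x₀`
  set D : ℝ := 2 * Real.exp 24 * (c ^ 3)⁻¹ with hD
  have hc3 : 0 < c ^ 3 := pow_pos hc 3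
  have hD1 : 1 ≤ D := by
    have h1 : (1 : ℝ) ≤ (c ^ 3)⁻¹ := (one_le_inv₀ hc3).mpr (pow_le_one₀ hc.le hc1)
    have h2 : (1 : ℝ) ≤ Real.exp 24 := Real.one_le_exp (by norm_num)
    rw [hD]; nlinarith
  have hD0 : 0 < D := one_pos.trans_le hD1
  set A : ℝ := Real.log D with hA
  have hA0 : 0 ≤ A := Real.log_nonneg hD1
  set x₀ : ℝ := (8 * A + 72) / b₀ ^ 2 with hx₀
  have hx₀0 : 0 ≤ x₀ := div_nonneg (by linarith) (pow_pos hb₀ 2).le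
  refine ⟨Real.exp (-(2 * x₀)), Real.exp_pos _, by rw [Real.exp_le_one_iff]; linarith, fun F γ hγ hγ1 K S => ?_⟩
  have hγ1' : γ ≤ 1 := hγ1.trans (by rw [Real.exp_le_one_iff]; linarith)
  obtain ⟨hg2pos, hg2le, hβ1⟩ := coupling_facts F hγ hγ1' K
  set g : ℝ := Real.sqrt (γ * ((F.L : ℝ)⁻¹) ^ K) with hgdef
  have hgpos : 0 < g := Real.sqrt_pos.mpr hg2pos
  have hg1 : g ≤ 1 := by rw [hgdef]; exact Real.sqrt_le_one.mpr (hg2le.trans hγ1')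
  set β : ℝ := (γ * ((F.L : ℝ)⁻¹) ^ K)⁻¹ with hβdef
  have hβeq : (F.scheme ℰp γ).β K = β := rfl
  have hβ0 : 0 < β := one_pos.trans_le hβ1
  -- `√β = g⁻¹`, `log √β = log g⁻¹ ≥ x₀`
  have hsqrtβ : Real.sqrt β = g⁻¹ := by rw [hβdef, Real.sqrt_inv, hgdef]
  have hlogg : x₀ ≤ Real.log g⁻¹ := by
    -- `g² ≤ γ ≤ exp(−2x₀)`, so `2·log g ≤ −2x₀`
    have hg2 : g ^ 2 ≤ Real.exp (-(2 * x₀)) := by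
      rw [hgdef, Real.sq_sqrt hg2pos.le]; exact hg2le.trans hγ1
    have hlog2 : Real.log (g ^ 2) ≤ -(2 * x₀) := by
      rw [← Real.log_exp (-(2 * x₀))]; exact Real.log_le_log (pow_pos hgpos 2) hg2
    rw [Real.log_pow] at hlog2
    rw [Real.log_inv]
    push_cast at hlog2
    linarith
  have hp0 : 0 ≤ B10.pFun b₀ p₀ g := pFun_nonneg hb₀.le hgpos hg1
  set p : ℝ := B10.pFun b₀ p₀ g with hpdef
  -- the joint chessboard tail
  have hS := htail F γ hγ b₀ p₀ K (hβeq ▸ hβ1) hp0 S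
  rw [hβeq] at hS
  refine hS.trans ?_
  -- `δ ≤ exp(−p²/8)`
  have hent : 8 * A + 72 * Real.log g⁻¹ ≤ p ^ 2 := sq_pFun_ge hb₀ hp₀ hA0 hlogg
  have hδ : D * Real.sqrt β ^ 9 * Real.exp (-(p ^ 2 / 4)) ≤ Real.exp (-(p ^ 2 / 8)) := by
    have hDexp : D = Real.exp A := by rw [hA, Real.exp_log hD0]
    have h9 : Real.sqrt β ^ 9 = Real.exp (9 * Real.log g⁻¹) := by
      rw [hsqrtβ, ← Real.exp_log (inv_pos.mpr hgpos), ← Real.exp_nat_mul, Real.log_exp]; norm_num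
    rw [hDexp, h9, ← Real.exp_add, ← Real.exp_add, Real.exp_le_exp]
    linarith
  have hmin : min (D * Real.sqrt β ^ 9 * Real.exp (-(p ^ 2 / 4))) 1 ≤ Real.exp (-(p ^ 2 / 8)) := (min_le_left _ _).trans hδ
  have hmin0 : 0 ≤ min (D * Real.sqrt β ^ 9 * Real.exp (-(p ^ 2 / 4))) 1 := le_min (by positivity) zero_le_one
  calc (min (2 * Real.exp 24 * (c ^ 3)⁻¹ * Real.sqrt β ^ 9 * Real.exp (-(p ^ 2 / 4))) 1) ^ ((S.card : ℝ) / 3)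
      = (min (D * Real.sqrt β ^ 9 * Real.exp (-(p ^ 2 / 4))) 1) ^ ((S.card : ℝ) / 3) := by rw [hD]
    _ ≤ Real.exp (-(p ^ 2 / 8)) ^ ((S.card : ℝ) / 3) := Real.rpow_le_rpow hmin0 hmin (by positivity)
    _ = Real.exp (-(p ^ 2 / 24) * (S.card : ℝ)) := by rw [← Real.exp_mul]; congr 1; ring

end Peierls

/-! ## §2 The bare uniform large-field count: the EDGE stub at `j = 0` -/

section Count

/-- **THE BARE FACE OF THE UNIFORM LARGE-FIELD COUNT** (clean form; constants `c₀ = 1/24`, `C₀ = log 2`, `γ₁ = γ₁(b₀)`): for `0 < b₀`, `1 ≤ p₀`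
there is `γ₁ ∈ (0, 1]` such that for every family `F`, every `0 < γ ≤ γ₁` and every cut-off `K`,
`∫ exp((1/24)·p(g_K)²·#{q : θ(K) ≤ |U(∂q) − 1|}) dGibbs_K ≤ exp(log 2 · #Plaq_0)` — §1 for all subfamilies and «joint Peierls ⇒ count moment»
(`integral_exp_count_le_of_jointPeierls` with `s = t = p²/24`, `B = 1`). [cite: Balaban1985UV3, (7) p.257 and (71) p.273] -/
theorem bare_uniformLargeFieldCount_clean {b₀ p₀ : ℝ} (hb₀ : 0 < b₀) (hp₀ : 1 ≤ p₀) :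
    ∃ γ₁ : ℝ, 0 < γ₁ ∧ γ₁ ≤ 1 ∧ ∀ (F : T3Family) (γ : ℝ), 0 < γ → γ ≤ γ₁ → ∀ (K : ℕ),
      ∫ U, Real.exp ((1 / 24) * B10.pFun b₀ p₀ (Real.sqrt (γ * ((F.L : ℝ)⁻¹) ^ K)) ^ 2 *
          ∑ a : Plaq (F.P K) 0, (if θBal F.L γ b₀ p₀ K ≤ GaugeGroup.dist1 (GaugeField.plaqHol U a) then (1 : ℝ) else 0))
          ∂(gibbsK F ℰp γ K) ≤
        Real.exp (Real.log 2 * (Fintype.card (Plaq (F.P K) 0) : ℝ)) := by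
  obtain ⟨γ₁, hγ₁, hγ₁1, hP⟩ := jointPeierls_bare hb₀ hp₀
  refine ⟨γ₁, hγ₁, hγ₁1, fun F γ hγ hγ1 K => ?_⟩
  set t : ℝ := B10.pFun b₀ p₀ (Real.sqrt (γ * ((F.L : ℝ)⁻¹) ^ K)) ^ 2 / 24 with ht
  have ht0 : 0 ≤ t := by positivity
  have hcount := integral_exp_count_le_of_jointPeierls F hγ.le K 0 (θBal F.L γ b₀ p₀ K) (s := t) (t := t) (B := 1) ht0 le_rfl
    zero_le_one (fun S => by rw [one_mul]; exact hP F γ hγ hγ1 K S)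
  have h2 : (1 : ℝ) * 2 ^ Fintype.card (Plaq (F.P K) 0) = Real.exp (Real.log 2 * (Fintype.card (Plaq (F.P K) 0) : ℝ)) := by
    rw [one_mul, mul_comm, Real.exp_nat_mul, Real.exp_log two_pos]
  have hts : (1 : ℝ) / 24 * B10.pFun b₀ p₀ (Real.sqrt (γ * ((F.L : ℝ)⁻¹) ^ K)) ^ 2 = t := by rw [ht]; ring
  rw [hts, ← h2]
  exact hcount

/-- **THE BARE FACE OF THE UNIFORM LARGE-FIELD COUNT, IN THE LETTERS OF THE REGISTERED STUB**: the statement of `stub_uniformLargeFieldCount`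
(skeleton v4 of crux `CappedCoarseStiffnessL`, `Cruxes/CappedCoarseStiffnessL/Lines/birth.lean`) with its height variable `j` specialised to `0`
(`K − 0 = K`, `Ū^0 = U` definitionally) HOLDS — same quantifier block (`∃ c₀ C₀ γ₁` before `F, γ, K`), `c₀ = 1/24`, `C₀ = log 2`, `γ₁ = γ₁(b₀)`;
the hypotheses `F.L = L` and `2 < p₀` of the stub are not needed (only `p₀ ≥ 1` is used).  The heights `j ≥ 1` of the stub (block-averaged
plaquettes: the located content of [Balaban1985UV3] (71)) are NOT covered. [cite: Balaban1985UV3, (7) p.257 and (71) p.273] -/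
theorem bare_uniformLargeFieldCount :
    ∀ (L : ℕ) (b₀ p₀ : ℝ), 0 < b₀ → 2 < p₀ → ∃ (c₀ C₀ γ₁ : ℝ), 0 < c₀ ∧ 0 < γ₁ ∧ γ₁ ≤ 1 ∧
      ∀ (F : T3Family) (γ : ℝ), F.L = L → 0 < γ → γ ≤ γ₁ → ∀ (K : ℕ),
        ∫ U, Real.exp (c₀ * B10.pFun b₀ p₀ (Real.sqrt (γ * ((F.L : ℝ)⁻¹) ^ (K - 0))) ^ 2 *
            ∑ a : Plaq (F.P K) 0, (if T3UnitScaleTilt.θBal F.L γ b₀ p₀ (K - 0) ≤ GaugeGroup.dist1 (GaugeField.plaqHol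
              (Averaging.iter (fun i => BlockAveraging.blockAvg (P := F.P K) (j := i) T3UnitLawDensityEML.ℰp) 0 U) a)
              then (1 : ℝ) else 0)) ∂(T3UnitScaleTilt.gibbsK F T3UnitLawDensityEML.ℰp γ K) ≤
          Real.exp (C₀ * (Fintype.card (Plaq (F.P K) 0) : ℝ)) := by
  intro L b₀ p₀ hb₀ hp₀
  obtain ⟨γ₁, hγ₁, hγ₁1, h⟩ := bare_uniformLargeFieldCount_clean hb₀ (by linarith)
  exact ⟨1 / 24, Real.log 2, γ₁, by norm_num, hγ₁, hγ₁1, fun F γ _ hγ hγ1 K => h F γ hγ hγ1 K⟩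

end Count

/-! ## §3 For the skeleton: the EDGE stub follows from its `j ≥ 1` part (the `j = 0` part is §2) -/

section Split

variable (F : T3Family)

/-- Monotonicity of the count exponential moment in the tilt: `∫ e^{c·p²·N_j} ≤ ∫ e^{c'·p²·N_j}` for `c ≤ c'`, `0 ≤ c'` (bounded integrands on a
probability space). [folklore] -/
theorem integral_exp_count_mono {γ : ℝ} (hγ : 0 ≤ γ) (b₀ p₀ : ℝ) (K j : ℕ) {c c' : ℝ} (hcc' : c ≤ c') (hc' : 0 ≤ c') :
    ∫ U, Real.exp (c * B10.pFun b₀ p₀ (Real.sqrt (γ * ((F.L : ℝ)⁻¹) ^ (K - j))) ^ 2 *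
        ∑ a : Plaq (F.P K) j, (if θBal F.L γ b₀ p₀ (K - j) ≤ GaugeGroup.dist1 (GaugeField.plaqHol
          (Averaging.iter (fun i => BlockAveraging.blockAvg (P := F.P K) (j := i) ℰp) j U) a) then (1 : ℝ) else 0))
        ∂(gibbsK F ℰp γ K) ≤
      ∫ U, Real.exp (c' * B10.pFun b₀ p₀ (Real.sqrt (γ * ((F.L : ℝ)⁻¹) ^ (K - j))) ^ 2 *
        ∑ a : Plaq (F.P K) j, (if θBal F.L γ b₀ p₀ (K - j) ≤ GaugeGroup.dist1 (GaugeField.plaqHol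
          (Averaging.iter (fun i => BlockAveraging.blockAvg (P := F.P K) (j := i) ℰp) j U) a) then (1 : ℝ) else 0))
        ∂(gibbsK F ℰp γ K) := by
  haveI := isProbabilityMeasure_gibbsK F ℰp hγ K
  set q : ℝ := B10.pFun b₀ p₀ (Real.sqrt (γ * ((F.L : ℝ)⁻¹) ^ (K - j))) ^ 2 with hq
  have hq0 : 0 ≤ q := sq_nonneg _
  set θ : ℝ := θBal F.L γ b₀ p₀ (K - j) with hθ
  -- integrability of the larger integrand (bounded by `exp(c'·q·#Plaq_j)`)
  have hint : Integrable (fun U => Real.exp (c' * q * ∑ a : Plaq (F.P K) j, (if θ ≤ GaugeGroup.dist1 (GaugeField.plaqHol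
      (Averaging.iter (fun i => BlockAveraging.blockAvg (P := F.P K) (j := i) ℰp) j U) a) then (1 : ℝ) else 0))) (gibbsK F ℰp γ K) := by
    have hmeas : Measurable fun U => Real.exp (c' * q * ∑ a : Plaq (F.P K) j, (if θ ≤ GaugeGroup.dist1 (GaugeField.plaqHol
        (Averaging.iter (fun i => BlockAveraging.blockAvg (P := F.P K) (j := i) ℰp) j U) a) then (1 : ℝ) else 0)) :=
      Real.measurable_exp.comp ((measurable_count F K j θ).const_mul (c' * q))
    refine (integrable_const (Real.exp (c' * q * (Fintype.card (Plaq (F.P K) j) : ℝ)))).mono' hmeas.aestronglyMeasurable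
      (ae_of_all _ fun U => ?_)
    rw [Real.norm_eq_abs, abs_of_pos (Real.exp_pos _)]
    exact Real.exp_le_exp.mpr (mul_le_mul_of_nonneg_left (count_mem F K j θ U).2 (mul_nonneg hc' hq0))
  refine integral_mono_of_nonneg (ae_of_all _ fun U => (Real.exp_pos _).le) hint (ae_of_all _ fun U => ?_)
  refine Real.exp_le_exp.mpr (mul_le_mul_of_nonneg_right (mul_le_mul_of_nonneg_right hcc' hq0) (count_mem F K j θ U).1)

/-- **THE EDGE STUB FROM ITS `j ≥ 1` PART.**  If the uniform large-field count holds at all heights `1 ≤ j ≤ K` (the located content of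
[Balaban1985UV3] (71): block-averaged plaquettes), then it holds at all heights `j ≤ K` — the height `j = 0` is §2 (`bare_uniformLargeFieldCount`);
constants `(min c₀ c₀', max C₀ C₀', min γ₁ γ₁')` by monotonicity in the tilt and in the allowance.  The statement in the conclusion is VERBATIM the
registered stub `stub_uniformLargeFieldCount` of skeleton v4; the hypothesis is the stub of skeleton v5. [cite: Balaban1985UV3, (71) p.273] -/
theorem uniformLargeFieldCount_of_pos
    (hpos : ∀ (L : ℕ) (b₀ p₀ : ℝ), 0 < b₀ → 2 < p₀ → ∃ (c₀ C₀ γ₁ : ℝ), 0 < c₀ ∧ 0 < γ₁ ∧ γ₁ ≤ 1 ∧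
      ∀ (F : T3Family) (γ : ℝ), F.L = L → 0 < γ → γ ≤ γ₁ → ∀ (K j : ℕ), 1 ≤ j → j ≤ K →
        ∫ U, Real.exp (c₀ * B10.pFun b₀ p₀ (Real.sqrt (γ * ((F.L : ℝ)⁻¹) ^ (K - j))) ^ 2 *
            ∑ a : Plaq (F.P K) j, (if T3UnitScaleTilt.θBal F.L γ b₀ p₀ (K - j) ≤ GaugeGroup.dist1 (GaugeField.plaqHol
              (Averaging.iter (fun i => BlockAveraging.blockAvg (P := F.P K) (j := i) T3UnitLawDensityEML.ℰp) j U) a)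
              then (1 : ℝ) else 0)) ∂(T3UnitScaleTilt.gibbsK F T3UnitLawDensityEML.ℰp γ K) ≤
          Real.exp (C₀ * (Fintype.card (Plaq (F.P K) j) : ℝ))) :
    ∀ (L : ℕ) (b₀ p₀ : ℝ), 0 < b₀ → 2 < p₀ → ∃ (c₀ C₀ γ₁ : ℝ), 0 < c₀ ∧ 0 < γ₁ ∧ γ₁ ≤ 1 ∧
      ∀ (F : T3Family) (γ : ℝ), F.L = L → 0 < γ → γ ≤ γ₁ → ∀ (K j : ℕ), j ≤ K →
        ∫ U, Real.exp (c₀ * B10.pFun b₀ p₀ (Real.sqrt (γ * ((F.L : ℝ)⁻¹) ^ (K - j))) ^ 2 *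
            ∑ a : Plaq (F.P K) j, (if T3UnitScaleTilt.θBal F.L γ b₀ p₀ (K - j) ≤ GaugeGroup.dist1 (GaugeField.plaqHol
              (Averaging.iter (fun i => BlockAveraging.blockAvg (P := F.P K) (j := i) T3UnitLawDensityEML.ℰp) j U) a)
              then (1 : ℝ) else 0)) ∂(T3UnitScaleTilt.gibbsK F T3UnitLawDensityEML.ℰp γ K) ≤
          Real.exp (C₀ * (Fintype.card (Plaq (F.P K) j) : ℝ)) := by
  intro L b₀ p₀ hb₀ hp₀
  obtain ⟨c₁, C₁, γ₁, hc₁, hγ₁, hγ₁1, h0⟩ := bare_uniformLargeFieldCount L b₀ p₀ hb₀ hp₀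
  obtain ⟨c₂, C₂, γ₂, hc₂, hγ₂, -, h1⟩ := hpos L b₀ p₀ hb₀ hp₀
  refine ⟨min c₁ c₂, max C₁ C₂, min γ₁ γ₂, lt_min hc₁ hc₂, lt_min hγ₁ hγ₂, (min_le_left _ _).trans hγ₁1,
    fun F γ hL hγ hγm K j hjK => ?_⟩
  have hcard : (0 : ℝ) ≤ (Fintype.card (Plaq (F.P K) j) : ℝ) := Nat.cast_nonneg _
  rcases Nat.eq_zero_or_pos j with hj0 | hj1
  · subst hj0
    calc _ ≤ _ := integral_exp_count_mono F hγ.le b₀ p₀ K 0 (min_le_left c₁ c₂) hc₁.le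
      _ ≤ Real.exp (C₁ * (Fintype.card (Plaq (F.P K) 0) : ℝ)) := h0 F γ hL hγ (hγm.trans (min_le_left _ _)) K
      _ ≤ _ := Real.exp_le_exp.mpr (mul_le_mul_of_nonneg_right (le_max_left _ _) hcard)
  · calc _ ≤ _ := integral_exp_count_mono F hγ.le b₀ p₀ K j (min_le_right c₁ c₂) hc₂.le
      _ ≤ Real.exp (C₂ * (Fintype.card (Plaq (F.P K) j) : ℝ)) := h1 F γ hL hγ (hγm.trans (min_le_right _ _)) K j hj1 hjK
      _ ≤ _ := Real.exp_le_exp.mpr (mul_le_mul_of_nonneg_right (le_max_right _ _) hcard)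

end Split

end Summit.QuantumFields.YangMills.Theorems.CoarseStiffnessTailBareUniformCount

end
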